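import Summits.CriticalPhenomena.PercolationContinuityZ3.Theorems.Transplant.SkelFrmBChoiceRootRun
import HarnessLib

/-!
# N2 (frames-only node `SamePDropOfSkeletonFrm₁`, OPEN), (R) column FIRST axis — **THE ROOT x-ARRIVAL BOX AGAINST (C)'s**: cell-free
# `Skelφ.KGRows.kgM₁_sub_mul_le_N` / `KGRows.kgM₂_sub_mul_le_N` (growth of `m₁`, `m₂ + 1` with the run length is controlled by `T₁`, `T₂`), then at
# the root's run length `N_R ≤ kgNv0`: `KS.dN_R_le` (`kgNv0 − N_R ≤ 106`), `KS.dm₁_R_le` (`m₁(kgNv0) − m₁(N_R) ∈ {0,1}`), `KS.dm₂_R_le`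
# (`(m₂(kgNv0)+1) − (m₂(N_R)+1) ≤ 3`), and **`KS.rootBoxX_R`**: with the landing offset `X1` along, the root's arrival box `[kgLastLo N_R, kgLastHi N_R]`
# sits inside (C)'s `[kgLastLo kgNv0, kgLastHi kgNv0]` widened by `3·n_L` along (both far edges lie in the centring window
# `(kgTgt0 − n_L − Δ₀, kgTgt0]`) and by `2·sL` below / `0` above across (rows) — the hypotheses of stmt's x-arrival box-reading rows (ask (3)).
Generic in `(qx, Wx)` under `qx ≤ 100·n_L`, `Wx ≤ 20·sL`, the floors, the (R) f-floor, and (C)'s first-step fit `h0C` as a hypothesis.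
builds on p205010 (kernel theorem, internal audit signed; external expert review pending) — nothing in this file uses p205010; nothing here is a
claim about the open node `SamePDropOfSkeletonFrm₁`.
Lane `prim-bschramm`, seat `prim-bschramm-p3` (gen 17; (R) lineage); helper file (`--supports stmt-CriticalPhenomena-4575 --as helper`).
[cite: KozmaNitzan2024, §4 Lemma 12 (pp. 23–25: the target box)]
-/

noncomputable section

open scoped Classical

namespace Summit.CriticalPhenomena.PercolationContinuityZ3.Theorems.Transplant

namespace Skelφ

open Literature.Probability.Percolation Literature.Probability.LatticeModels SimpleGraph

section NMono

variable {n ℓ : ℕ} {hs v : ℤ} {R' ρ q W : ℕ}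

/-- **`dec₁·(m₁(N′) − m₁(N)) ≤ 2(N′ − N)R′ + dec₁ − 1`** (`m₁ + 1 = ⌊T₁/dec₁⌋`, `T₁(N′) − T₁(N) = 2(N′ − N)R′`). [this work] -/
theorem KGRows.kgM₁_sub_mul_le_N (H : KGRows n ℓ hs v R' ρ q W) (N N' : ℕ) :
    kgDec₁ n ℓ hs R' ρ * (((kgM₁ n ℓ hs R' ρ W N' : ℕ) : ℤ) - (kgM₁ n ℓ hs R' ρ W N : ℕ)) ≤
      2 * ((N' : ℤ) - N) * R' + kgDec₁ n ℓ hs R' ρ - 1 := by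
  have hd0 : 0 < kgDec₁ n ℓ hs R' ρ := by
    have := H.dec₁_pos; have : (0 : ℤ) ≤ R' := by positivity
    linarith
  obtain ⟨he, -⟩ := H.kgM₁_spec N
  obtain ⟨he', -⟩ := H.kgM₁_spec N'
  have h1 := Int.ediv_mul_le (kgT₁ R' W N') (ne_of_gt hd0)
  have h2 := Int.lt_ediv_add_one_mul_self (kgT₁ R' W N) hd0
  rw [← he'] at h1
  rw [← he] at h2
  have eT : kgT₁ R' W N' - kgT₁ R' W N = 2 * ((N' : ℤ) - N) * R' := by unfold kgT₁; ring
  nlinarith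

/-- **`dec₂·((m₂(N′)+1) − (m₂(N)+1)) ≤ (T₂(N′) − T₂(N)) + dec₂ − 1`** for `N ≤ N′` (ceilings and `max 1 ·` are monotone and 1-Lipschitz). [this work] -/
theorem KGRows.kgM₂_sub_mul_le_N (H : KGRows n ℓ hs v R' ρ q W) {N N' : ℕ} (hN : N ≤ N') :
    kgDec₂ n R' ρ * ((((kgM₂ n ℓ hs v R' ρ q W N' : ℕ) : ℤ) + 1) - (((kgM₂ n ℓ hs v R' ρ q W N : ℕ) : ℤ) + 1)) ≤
      (kgT₂ n ℓ hs v R' ρ q W N' - kgT₂ n ℓ hs v R' ρ q W N) + kgDec₂ n R' ρ - 1 := by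
  have hd0 : 0 < kgDec₂ n R' ρ := by
    have := H.dec₂_pos.1; have : (0 : ℤ) ≤ R' := by positivity
    have : (0 : ℤ) ≤ ρ := by positivity
    linarith
  obtain ⟨he, -⟩ := H.kgM₂_spec N
  obtain ⟨he', -⟩ := H.kgM₂_spec N'
  have hT := H.kgT₂_mono hN
  set d := kgDec₂ n R' ρ with hd
  set T := kgT₂ n ℓ hs v R' ρ q W N with hTdef
  set T' := kgT₂ n ℓ hs v R' ρ q W N' with hT'def
  set c := (T + d - 1) / d with hc
  set c' := (T' + d - 1) / d with hc'
  rw [he, he']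
  have h1 := Int.ediv_mul_le (T' + d - 1) (ne_of_gt hd0)
  have h2 := Int.lt_ediv_add_one_mul_self (T + d - 1) hd0
  rw [← hc'] at h1
  rw [← hc] at h2
  have hcc : d * (c' - c) ≤ (T' - T) + d - 1 := by nlinarith
  have hmono : c ≤ c' := Int.ediv_le_ediv hd0 (by linarith)
  rcases le_or_gt 1 c with hc1 | hc1
  · rw [max_eq_right hc1, max_eq_right (hc1.trans hmono)]; exact hcc
  · rw [max_eq_left hc1.le]
    rcases le_or_gt 1 c' with hc1' | hc1'
    · rw [max_eq_right hc1']
      have : d * (c' - 1) ≤ d * (c' - c) := by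
        apply mul_le_mul_of_nonneg_left _ hd0.le; linarith
      linarith
    · rw [max_eq_left hc1'.le]
      have : (0 : ℤ) ≤ T' - T := by linarith
      nlinarith

end NMono

end Skelφ

namespace PlanarSkeletonFrm

namespace NegB

open Literature.Probability.Percolation Literature.Probability.LatticeModels SimpleGraph
open SkelConc (Consts)
open Skelφ (shearUnit kgSL kgP kgΔ kgN KGRows kgFar kgX kgX₂ kgM₁ kgM₂ kgT₁ kgT₂ kgWm₂ kgWp₂ kgCtr2 kgHw2 kgDec₁ kgDec₂)
open Neg

namespace KS

section BoxX

variable (κ : Consts) {V : Type} [DecidableEq V] [Countable V] {G : SimpleGraph V} [G.LocallyFinite] (Φ : PlanarSkeletonFrm G) (t : V) (p : unitInterval)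
  (D : Skelφ.StepI.DataNS V) (mk g f qx Wx : ℕ)

/-- The floors in terms of `kgR` (= `KS0.R'0`, by `rfl`): `1600·R′ + 1 ≤ n_L`, `1600·R′ ≤ sL + 1`, `958 ≤ sL`, `8R′ + 7 ≤ n_L`, `|v_L| ≤ n_L`,
`1 ≤ n_L`. [folklore] -/
theorem rootRun_floorsR (hN : EqNumL κ Φ t p D g f) (hg : gFloorKG κ Φ t p D mk ≤ g) (hg2 : 40 * Neg.K κ * KS0.R'0 κ Φ t p D mk ≤ g) :
    1600 * ((((kgR κ Φ t p D mk) : ℕ)) : ℤ) + 1 ≤ (nL κ Φ t p D g f : ℤ) ∧ 1600 * ((((kgR κ Φ t p D mk) : ℕ)) : ℤ) ≤ (kgSL (nL κ Φ t p D g f) (ℓL κ Φ t p D g f) (hL κ Φ t p D g f)) + 1 ∧ 958 ≤ (kgSL (nL κ Φ t p D g f) (ℓL κ Φ t p D g f) (hL κ Φ t p D g f)) ∧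
      8 * ((((kgR κ Φ t p D mk) : ℕ)) : ℤ) + 7 ≤ (nL κ Φ t p D g f : ℤ) ∧ |(vL κ Φ t p D g f)| ≤ (nL κ Φ t p D g f : ℤ) ∧ (1 : ℤ) ≤ (nL κ Φ t p D g f : ℤ) := by
  obtain ⟨hKR, hKs, h958, hK, h8, hv, hn1⟩ := rootRun_floors κ Φ t p D mk g f hN hg hg2
  have hR0 : (0 : ℤ) ≤ (((KS0.R'0 κ Φ t p D mk : ℕ)) : ℤ) := by positivity
  have h1 : 1600 * (((KS0.R'0 κ Φ t p D mk : ℕ)) : ℤ) + 1 ≤ (nL κ Φ t p D g f : ℤ) := by nlinarith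
  have h2 : 1600 * (((KS0.R'0 κ Φ t p D mk : ℕ)) : ℤ) ≤ (kgSL (nL κ Φ t p D g f) (ℓL κ Φ t p D g f) (hL κ Φ t p D g f)) + 1 := by nlinarith
  exact ⟨h1, h2, h958, h8, hv, hn1⟩

/-- **`kgNv0 − N_R ≤ 106`**: both far edges lie in the centring window, `kgFar` grows by at least `n_L` per step, and `X1 + n_L + Δ₀ < 107·n_L`.
[this work] -/
theorem dN_R_le (hN : EqNumL κ Φ t p D g f) (hg : gFloorKG κ Φ t p D mk ≤ g) (hg2 : 40 * Neg.K κ * KS0.R'0 κ Φ t p D mk ≤ g)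
    (hqx : qx ≤ 100 * nL κ Φ t p D g f) (hWx : (Wx : ℤ) ≤ 20 * (kgSL (nL κ Φ t p D g f) (ℓL κ Φ t p D g f) (hL κ Φ t p D g f))) (hf : KS.fxR0 κ Φ t p D mk ≤ f)
    (h0C : (kgFar (nL κ Φ t p D g f) (ℓL κ Φ t p D g f) (hL κ Φ t p D g f) (vL κ Φ t p D g f) (kgR κ Φ t p D mk) 0 (kgq κ Φ t p D g f qx) (kgW κ Φ t p D g f Wx) 0) ≤ (kgTgt0 κ Φ t p D g f mk)) :
    0 ≤ ((((kgNv0 κ Φ t p D g f mk qx Wx) : ℕ)) : ℤ) - ((((KS.kgNR κ Φ t p D mk g f qx Wx) : ℕ)) : ℤ) ∧ ((((kgNv0 κ Φ t p D g f mk qx Wx) : ℕ)) : ℤ) - ((((KS.kgNR κ Φ t p D mk g f qx Wx) : ℕ)) : ℤ) ≤ 106 := by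
  have H := (kgRows0_of κ Φ t p D g f mk qx Wx hN hg)
  obtain ⟨hC1, -⟩ := H.kgN_spec h0C
  have eN : kgN (nL κ Φ t p D g f) (ℓL κ Φ t p D g f) (hL κ Φ t p D g f) (vL κ Φ t p D g f) (kgR κ Φ t p D mk) 0 (kgq κ Φ t p D g f qx) (kgW κ Φ t p D g f Wx) (kgTgt0 κ Φ t p D g f mk) = (kgNv0 κ Φ t p D g f mk qx Wx) := rfl
  rw [eN] at hC1
  obtain ⟨-, hR2⟩ := kgNR_spec κ Φ t p D mk g f qx Wx hN hg hg2 hqx hWx hf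
  rw [kgTgtR_eq] at hR2
  have hle := kgNR_le_kgNv0 κ Φ t p D mk g f qx Wx hN hg hg2 hqx hWx hf
  have hle' : ((((KS.kgNR κ Φ t p D mk g f qx Wx) : ℕ)) : ℤ) ≤ ((((kgNv0 κ Φ t p D g f mk qx Wx) : ℕ)) : ℤ) := by exact_mod_cast hle
  have hXm := H.kgX_mono hle
  obtain ⟨-, hXhi⟩ := X1_bounds κ Φ t p D mk g f qx hf
  obtain ⟨h1600, -, -, h8, hv, hn1⟩ := rootRun_floorsR κ Φ t p D mk g f hN hg hg2
  have hqx' : ((qx : ℕ) : ℤ) ≤ 100 * (nL κ Φ t p D g f : ℤ) := by exact_mod_cast hqx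
  have hXhi' : (KS.X1 κ Φ t p D mk g f (kgq κ Φ t p D g f qx)) + 2 * ((((kgR κ Φ t p D mk) : ℕ)) : ℤ) + ((KS.Rs t D mk : ℕ) : ℤ) + 1 ≤ 4 * (nL κ Φ t p D g f : ℤ) + qx := hXhi
  have hRs : (0 : ℤ) ≤ ((KS.Rs t D mk : ℕ) : ℤ) := by positivity
  have hR0 : (0 : ℤ) ≤ ((((kgR κ Φ t p D mk) : ℕ)) : ℤ) := by positivity
  unfold kgFar at hC1 hR2
  unfold kgΔ at hR2
  push_cast at hC1 hR2
  refine ⟨by linarith, ?_⟩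
  -- (Nv − N_R)·n ≤ far^C − far^R < X1 + n + 8R + |v| ≤ 107·n − 1
  have key : (((((kgNv0 κ Φ t p D g f mk qx Wx) : ℕ)) : ℤ) - ((((KS.kgNR κ Φ t p D mk g f qx Wx) : ℕ)) : ℤ)) * (nL κ Φ t p D g f : ℤ) < 107 * (nL κ Φ t p D g f : ℤ) := by nlinarith
  have hn0 : (0 : ℤ) < (nL κ Φ t p D g f : ℤ) := by linarith
  by_contra hcon
  have h1 : (107 : ℤ) ≤ ((((kgNv0 κ Φ t p D g f mk qx Wx) : ℕ)) : ℤ) - ((((KS.kgNR κ Φ t p D mk g f qx Wx) : ℕ)) : ℤ) := by linarith [not_le.mp hcon]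
  have := mul_le_mul_of_nonneg_right h1 hn0.le
  linarith

/-- **`0 ≤ m₁(kgNv0) − m₁(N_R) ≤ 1`** (`dec₁·Δ ≤ 212·R′ + dec₁ − 1 < 2·dec₁`). [this work] -/
theorem dm₁_R_le (hN : EqNumL κ Φ t p D g f) (hg : gFloorKG κ Φ t p D mk ≤ g) (hg2 : 40 * Neg.K κ * KS0.R'0 κ Φ t p D mk ≤ g)
    (hqx : qx ≤ 100 * nL κ Φ t p D g f) (hWx : (Wx : ℤ) ≤ 20 * (kgSL (nL κ Φ t p D g f) (ℓL κ Φ t p D g f) (hL κ Φ t p D g f))) (hf : KS.fxR0 κ Φ t p D mk ≤ f)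
    (h0C : (kgFar (nL κ Φ t p D g f) (ℓL κ Φ t p D g f) (hL κ Φ t p D g f) (vL κ Φ t p D g f) (kgR κ Φ t p D mk) 0 (kgq κ Φ t p D g f qx) (kgW κ Φ t p D g f Wx) 0) ≤ (kgTgt0 κ Φ t p D g f mk)) :
    0 ≤ ((((kgM₁ (nL κ Φ t p D g f) (ℓL κ Φ t p D g f) (hL κ Φ t p D g f) (kgR κ Φ t p D mk) 0 (kgW κ Φ t p D g f Wx) (kgNv0 κ Φ t p D g f mk qx Wx))) : ℕ) : ℤ) - ((((kgM₁ (nL κ Φ t p D g f) (ℓL κ Φ t p D g f) (hL κ Φ t p D g f) (kgR κ Φ t p D mk) 0 (kgW κ Φ t p D g f Wx) (KS.kgNR κ Φ t p D mk g f qx Wx))) : ℕ) : ℤ) ∧ ((((kgM₁ (nL κ Φ t p D g f) (ℓL κ Φ t p D g f) (hL κ Φ t p D g f) (kgR κ Φ t p D mk) 0 (kgW κ Φ t p D g f Wx) (kgNv0 κ Φ t p D g f mk qx Wx))) : ℕ) : ℤ) - ((((kgM₁ (nL κ Φ t p D g f) (ℓL κ Φ t p D g f) (hL κ Φ t p D g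 f) (kgR κ Φ t p D mk) 0 (kgW κ Φ t p D g f Wx) (KS.kgNR κ Φ t p D mk g f qx Wx))) : ℕ) : ℤ) ≤ 1 := by
  have H := (kgRows0_of κ Φ t p D g f mk qx Wx hN hg)
  have hle := kgNR_le_kgNv0 κ Φ t p D mk g f qx Wx hN hg hg2 hqx hWx hf
  have hmono : ((((kgM₁ (nL κ Φ t p D g f) (ℓL κ Φ t p D g f) (hL κ Φ t p D g f) (kgR κ Φ t p D mk) 0 (kgW κ Φ t p D g f Wx) (KS.kgNR κ Φ t p D mk g f qx Wx))) : ℕ) : ℤ) ≤ ((((kgM₁ (nL κ Φ t p D g f) (ℓL κ Φ t p D g f) (hL κ Φ t p D g f) (kgR κ Φ t p D mk) 0 (kgW κ Φ t p D g f Wx) (kgNv0 κ Φ t p D g f mk qx Wx))) : ℕ) : ℤ) := by exact_mod_cast H.kgM₁_mono hle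
  have hm := H.kgM₁_sub_mul_le_N (KS.kgNR κ Φ t p D mk g f qx Wx) (kgNv0 κ Φ t p D g f mk qx Wx)
  obtain ⟨hdN0, hdN⟩ := dN_R_le κ Φ t p D mk g f qx Wx hN hg hg2 hqx hWx hf h0C
  obtain ⟨-, h1600s, h958, -, -, -⟩ := rootRun_floorsR κ Φ t p D mk g f hN hg hg2
  have ed : kgDec₁ (nL κ Φ t p D g f) (ℓL κ Φ t p D g f) (hL κ Φ t p D g f) (kgR κ Φ t p D mk) 0 = (kgSL (nL κ Φ t p D g f) (ℓL κ Φ t p D g f) (hL κ Φ t p D g f)) - 2 * (((kgR κ Φ t p D mk) : ℕ) : ℤ) - ((0 : ℕ) : ℤ) := rfl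
  rw [ed] at hm
  push_cast at hm
  have hR0 : (0 : ℤ) ≤ (((kgR κ Φ t p D mk) : ℕ) : ℤ) := by positivity
  have hprod : 2 * (((((kgNv0 κ Φ t p D g f mk qx Wx) : ℕ)) : ℤ) - ((((KS.kgNR κ Φ t p D mk g f qx Wx) : ℕ)) : ℤ)) * (((kgR κ Φ t p D mk) : ℕ) : ℤ) ≤ 212 * (((kgR κ Φ t p D mk) : ℕ) : ℤ) := by nlinarith
  have hpos : 0 < (kgSL (nL κ Φ t p D g f) (ℓL κ Φ t p D g f) (hL κ Φ t p D g f)) - 2 * (((kgR κ Φ t p D mk) : ℕ) : ℤ) := by linarith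
  refine ⟨by linarith, ?_⟩
  have hlt : ((kgSL (nL κ Φ t p D g f) (ℓL κ Φ t p D g f) (hL κ Φ t p D g f)) - 2 * (((kgR κ Φ t p D mk) : ℕ) : ℤ)) * (((((kgM₁ (nL κ Φ t p D g f) (ℓL κ Φ t p D g f) (hL κ Φ t p D g f) (kgR κ Φ t p D mk) 0 (kgW κ Φ t p D g f Wx) (kgNv0 κ Φ t p D g f mk qx Wx))) : ℕ) : ℤ) - ((((kgM₁ (nL κ Φ t p D g f) (ℓL κ Φ t p D g f) (hL κ Φ t p D g f) (kgR κ Φ t p D mk) 0 (kgW κ Φ t p D g f Wx) (KS.kgNR κ Φ t p D mk g f qx Wx))) : ℕ) : ℤ)) <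
      ((kgSL (nL κ Φ t p D g f) (ℓL κ Φ t p D g f) (hL κ Φ t p D g f)) - 2 * (((kgR κ Φ t p D mk) : ℕ) : ℤ)) * 2 := by linarith
  have := lt_of_mul_lt_mul_left hlt hpos.le
  linarith

/-- **`0 ≤ (m₂(kgNv0)+1) − (m₂(N_R)+1) ≤ 3`** (`ΔT₂ = 2ΔX₂ ≤ 214R′ + 2n_L`, `dec₂ = n_L − 2R′`). [this work] -/
theorem dm₂_R_le (hN : EqNumL κ Φ t p D g f) (hg : gFloorKG κ Φ t p D mk ≤ g) (hg2 : 40 * Neg.K κ * KS0.R'0 κ Φ t p D mk ≤ g)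
    (hqx : qx ≤ 100 * nL κ Φ t p D g f) (hWx : (Wx : ℤ) ≤ 20 * (kgSL (nL κ Φ t p D g f) (ℓL κ Φ t p D g f) (hL κ Φ t p D g f))) (hf : KS.fxR0 κ Φ t p D mk ≤ f)
    (h0C : (kgFar (nL κ Φ t p D g f) (ℓL κ Φ t p D g f) (hL κ Φ t p D g f) (vL κ Φ t p D g f) (kgR κ Φ t p D mk) 0 (kgq κ Φ t p D g f qx) (kgW κ Φ t p D g f Wx) 0) ≤ (kgTgt0 κ Φ t p D g f mk)) :
    0 ≤ ((((kgM₂ (nL κ Φ t p D g f) (ℓL κ Φ t p D g f) (hL κ Φ t p D g f) (vL κ Φ t p D g f) (kgR κ Φ t p D mk) 0 (kgq κ Φ t p D g f qx) (kgW κ Φ t p D g f Wx) (kgNv0 κ Φ t p D g f mk qx Wx))) : ℕ) : ℤ) - ((((kgM₂ (nL κ Φ t p D g f) (ℓL κ Φ t p D g f) (hL κ Φ t p D g f) (vL κ Φ t p D g f) (kgR κ Φ t p D mk) 0 (kgq κ Φ t p D g f qx) (kgW κ Φ t p D g f Wx) (KS.kgNR κ Φ t p D mk g f qx Wx))) : ℕ)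 : ℤ) ∧ ((((kgM₂ (nL κ Φ t p D g f) (ℓL κ Φ t p D g f) (hL κ Φ t p D g f) (vL κ Φ t p D g f) (kgR κ Φ t p D mk) 0 (kgq κ Φ t p D g f qx) (kgW κ Φ t p D g f Wx) (kgNv0 κ Φ t p D g f mk qx Wx))) : ℕ) : ℤ) - ((((kgM₂ (nL κ Φ t p D g f) (ℓL κ Φ t p D g f) (hL κ Φ t p D g f) (vL κ Φ t p D g f) (kgR κ Φ t p D mk) 0 (kgq κ Φ t p D g f qx) (kgW κ Φ t p D g f Wx) (KS.kgNR κ Φ t p D mk g f qx Wx))) : ℕ) : ℤ) ≤ 3 := by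
  have H := (kgRows0_of κ Φ t p D g f mk qx Wx hN hg)
  have hle := kgNR_le_kgNv0 κ Φ t p D mk g f qx Wx hN hg hg2 hqx hWx hf
  have hmono : ((((kgM₂ (nL κ Φ t p D g f) (ℓL κ Φ t p D g f) (hL κ Φ t p D g f) (vL κ Φ t p D g f) (kgR κ Φ t p D mk) 0 (kgq κ Φ t p D g f qx) (kgW κ Φ t p D g f Wx) (KS.kgNR κ Φ t p D mk g f qx Wx))) : ℕ) : ℤ) ≤ ((((kgM₂ (nL κ Φ t p D g f) (ℓL κ Φ t p D g f) (hL κ Φ t p D g f) (vL κ Φ t p D g f) (kgR κ Φ t p D mk) 0 (kgq κ Φ t p D g f qx) (kgW κ Φ t p D g f Wx) (kgNv0 κ Φ t p D g f mk qx Wx))) : ℕ) : ℤ) := by exact_mod_cast H.kgM₂_mono hle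
  have hm := H.kgM₂_sub_mul_le_N hle
  obtain ⟨hdN0, hdN⟩ := dN_R_le κ Φ t p D mk g f qx Wx hN hg hg2 hqx hWx hf h0C
  obtain ⟨hΔ0, hΔ1⟩ := dm₁_R_le κ Φ t p D mk g f qx Wx hN hg hg2 hqx hWx hf h0C
  obtain ⟨h1600, -, -, -, hv, hn1⟩ := rootRun_floorsR κ Φ t p D mk g f hN hg hg2
  have ed : kgDec₂ (nL κ Φ t p D g f) (kgR κ Φ t p D mk) 0 = (nL κ Φ t p D g f : ℤ) - 2 * (((kgR κ Φ t p D mk) : ℕ) : ℤ) - ((0 : ℕ) : ℤ) := rfl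
  have eT : (kgT₂ (nL κ Φ t p D g f) (ℓL κ Φ t p D g f) (hL κ Φ t p D g f) (vL κ Φ t p D g f) (kgR κ Φ t p D mk) 0 (kgq κ Φ t p D g f qx) (kgW κ Φ t p D g f Wx) (kgNv0 κ Φ t p D g f mk qx Wx)) - (kgT₂ (nL κ Φ t p D g f) (ℓL κ Φ t p D g f) (hL κ Φ t p D g f) (vL κ Φ t p D g f) (kgR κ Φ t p D mk) 0 (kgq κ Φ t p D g f qx) (kgW κ Φ t p D g f Wx) (KS.kgNR κ Φ t p D mk g f qx Wx)) = 2 * ((((((kgNv0 κ Φ t p D g f mk qx Wx) : ℕ)) : ℤ) - ((((KS.kgNR κ Φ t p D mk g f qx Wx) : ℕ)) : ℤ)) * (((kgR κ Φ t p D mk) : ℕ) : ℤ) +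
      (((((kgM₁ (nL κ Φ t p D g f) (ℓL κ Φ t p D g f) (hL κ Φ t p D g f) (kgR κ Φ t p D mk) 0 (kgW κ Φ t p D g f Wx) (kgNv0 κ Φ t p D g f mk qx Wx))) : ℕ) : ℤ) - ((((kgM₁ (nL κ Φ t p D g f) (ℓL κ Φ t p D g f) (hL κ Φ t p D g f) (kgR κ Φ t p D mk) 0 (kgW κ Φ t p D g f Wx) (KS.kgNR κ Φ t p D mk g f qx Wx))) : ℕ) : ℤ)) * ((((kgR κ Φ t p D mk) : ℕ) : ℤ) + ((0 : ℕ) : ℤ) + |(vL κ Φ t p D g f)|)) := by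
    unfold kgT₂ kgX₂; push_cast; ring
  rw [ed, eT] at hm
  push_cast at hm
  have hR0 : (0 : ℤ) ≤ (((kgR κ Φ t p D mk) : ℕ) : ℤ) := by positivity
  have hva : (0 : ℤ) ≤ |(vL κ Φ t p D g f)| := abs_nonneg _
  have hprod1 : (((((kgNv0 κ Φ t p D g f mk qx Wx) : ℕ)) : ℤ) - ((((KS.kgNR κ Φ t p D mk g f qx Wx) : ℕ)) : ℤ)) * (((kgR κ Φ t p D mk) : ℕ) : ℤ) ≤ 106 * (((kgR κ Φ t p D mk) : ℕ) : ℤ) :=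
    mul_le_mul_of_nonneg_right hdN hR0
  have hprod2 : (((((kgM₁ (nL κ Φ t p D g f) (ℓL κ Φ t p D g f) (hL κ Φ t p D g f) (kgR κ Φ t p D mk) 0 (kgW κ Φ t p D g f Wx) (kgNv0 κ Φ t p D g f mk qx Wx))) : ℕ) : ℤ) - ((((kgM₁ (nL κ Φ t p D g f) (ℓL κ Φ t p D g f) (hL κ Φ t p D g f) (kgR κ Φ t p D mk) 0 (kgW κ Φ t p D g f Wx) (KS.kgNR κ Φ t p D mk g f qx Wx))) : ℕ) : ℤ)) * ((((kgR κ Φ t p D mk) : ℕ) : ℤ) + 0 + |(vL κ Φ t p D g f)|) ≤ 1 * ((((kgR κ Φ t p D mk) : ℕ) : ℤ) + 0 + |(vL κ Φ t p D g f)|) :=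
    mul_le_mul_of_nonneg_right hΔ1 (by linarith)
  have hpos : 0 < (nL κ Φ t p D g f : ℤ) - 2 * (((kgR κ Φ t p D mk) : ℕ) : ℤ) := by linarith
  refine ⟨by linarith, ?_⟩
  have hlt : ((nL κ Φ t p D g f : ℤ) - 2 * (((kgR κ Φ t p D mk) : ℕ) : ℤ)) * ((((((kgM₂ (nL κ Φ t p D g f) (ℓL κ Φ t p D g f) (hL κ Φ t p D g f) (vL κ Φ t p D g f) (kgR κ Φ t p D mk) 0 (kgq κ Φ t p D g f qx) (kgW κ Φ t p D g f Wx) (kgNv0 κ Φ t p D g f mk qx Wx))) : ℕ) : ℤ) + 1) - (((((kgM₂ (nL κ Φ t p D g f) (ℓL κ Φ t p D g f) (hL κ Φ t p D g f) (vL κ Φ t p D g f) (kgR κ Φ t p D mk) 0 (kgq κ Φ t p D g f qx) (kgW κ Φ t p D g f Wx) (KS.kgNR κ Φ t p D mk g f qx Wx))) : ℕ) : ℤ) + 1)) <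
      ((nL κ Φ t p D g f : ℤ) - 2 * (((kgR κ Φ t p D mk) : ℕ) : ℤ)) * 4 := by linarith
  have := lt_of_mul_lt_mul_left hlt hpos.le
  linarith

/-- **THE ROOT x-ARRIVAL BOX INSIDE (C)'s WIDENED** by `(3n_L, 3n_L)` along (with the landing offset `X1`) and `(2·sL, 0)` across:
`arrLo₀ − 3n_L ≤ X1 + lo₀^R`, `X1 + hi₀^R ≤ arrHi₀ + 3n_L`, `arrLo₁ − 2·sL ≤ lo₁^R`, `hi₁^R ≤ arrHi₁`. [this work] -/
theorem rootBoxX_R (hN : EqNumL κ Φ t p D g f) (hg : gFloorKG κ Φ t p D mk ≤ g) (hg2 : 40 * Neg.K κ * KS0.R'0 κ Φ t p D mk ≤ g)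
    (hqx : qx ≤ 100 * nL κ Φ t p D g f) (hWx : (Wx : ℤ) ≤ 20 * (kgSL (nL κ Φ t p D g f) (ℓL κ Φ t p D g f) (hL κ Φ t p D g f))) (hf : KS.fxR0 κ Φ t p D mk ≤ f)
    (h0C : (kgFar (nL κ Φ t p D g f) (ℓL κ Φ t p D g f) (hL κ Φ t p D g f) (vL κ Φ t p D g f) (kgR κ Φ t p D mk) 0 (kgq κ Φ t p D g f qx) (kgW κ Φ t p D g f Wx) 0) ≤ (kgTgt0 κ Φ t p D g f mk)) :
    ((kgRows0_of κ Φ t p D g f mk qx Wx hN hg).kgLastLo (kgNv0 κ Φ t p D g f mk qx Wx)) 0 - 3 * (nL κ Φ t p D g f : ℤ) ≤ (KS.X1 κ Φ t p D mk g f (kgq κ Φ t p D g f qx)) + ((kgRows0_of κ Φ t p D g f mk qx Wx hN hg).kgLastLo (KS.kgNR κ Φ t p D mk g f qx Wx)) 0 ∧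
    (KS.X1 κ Φ t p D mk g f (kgq κ Φ t p D g f qx)) + ((kgRows0_of κ Φ t p D g f mk qx Wx hN hg).kgLastHi (KS.kgNR κ Φ t p D mk g f qx Wx)) 0 ≤ ((kgRows0_of κ Φ t p D g f mk qx Wx hN hg).kgLastHi (kgNv0 κ Φ t p D g f mk qx Wx)) 0 + 3 * (nL κ Φ t p D g f : ℤ) ∧
    ((kgRows0_of κ Φ t p D g f mk qx Wx hN hg).kgLastLo (kgNv0 κ Φ t p D g f mk qx Wx)) 1 - 2 * (kgSL (nL κ Φ t p D g f) (ℓL κ Φ t p D g f) (hL κ Φ t p D g f)) ≤ ((kgRows0_of κ Φ t p D g f mk qx Wx hN hg).kgLastLo (KS.kgNR κ Φ t p D mk g f qx Wx)) 1 ∧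
    ((kgRows0_of κ Φ t p D g f mk qx Wx hN hg).kgLastHi (KS.kgNR κ Φ t p D mk g f qx Wx)) 1 ≤ ((kgRows0_of κ Φ t p D g f mk qx Wx hN hg).kgLastHi (kgNv0 κ Φ t p D g f mk qx Wx)) 1 := by
  have H := (kgRows0_of κ Φ t p D g f mk qx Wx hN hg)
  obtain ⟨hC1, hC2⟩ := H.kgN_spec h0C
  have eN : kgN (nL κ Φ t p D g f) (ℓL κ Φ t p D g f) (hL κ Φ t p D g f) (vL κ Φ t p D g f) (kgR κ Φ t p D mk) 0 (kgq κ Φ t p D g f qx) (kgW κ Φ t p D g f Wx) (kgTgt0 κ Φ t p D g f mk) = (kgNv0 κ Φ t p D g f mk qx Wx) := rfl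
  rw [eN] at hC1 hC2
  obtain ⟨hR1', hR2'⟩ := arrR_bounds κ Φ t p D mk g f qx Wx hN hg hg2 hqx hWx hf
  have hle := kgNR_le_kgNv0 κ Φ t p D mk g f qx Wx hN hg hg2 hqx hWx hf
  obtain ⟨hdN0, hdN⟩ := dN_R_le κ Φ t p D mk g f qx Wx hN hg hg2 hqx hWx hf h0C
  obtain ⟨hΔ0, hΔ1⟩ := dm₁_R_le κ Φ t p D mk g f qx Wx hN hg hg2 hqx hWx hf h0C
  obtain ⟨hΔ₂0, hΔ₂1⟩ := dm₂_R_le κ Φ t p D mk g f qx Wx hN hg hg2 hqx hWx hf h0C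
  obtain ⟨-, -, hER⟩ := H.kgE₁_spec (KS.kgNR κ Φ t p D mk g f qx Wx)
  obtain ⟨-, hEC, -⟩ := H.kgE₁_spec (kgNv0 κ Φ t p D g f mk qx Wx)
  obtain ⟨h1600, h1600s, h958, h8, hv, hn1⟩ := rootRun_floorsR κ Φ t p D mk g f hN hg hg2
  have ed : kgDec₁ (nL κ Φ t p D g f) (ℓL κ Φ t p D g f) (hL κ Φ t p D g f) (kgR κ Φ t p D mk) 0 = (kgSL (nL κ Φ t p D g f) (ℓL κ Φ t p D g f) (hL κ Φ t p D g f)) - 2 * (((kgR κ Φ t p D mk) : ℕ) : ℤ) - ((0 : ℕ) : ℤ) := rfl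
  rw [ed] at hER
  have eA : (((Skelφ.kgA₁ (nL κ Φ t p D g f) (ℓL κ Φ t p D g f) (hL κ Φ t p D g f) (kgR κ Φ t p D mk) (kgW κ Φ t p D g f Wx) (kgNv0 κ Φ t p D g f mk qx Wx)) : ℕ) : ℤ) - (((Skelφ.kgA₁ (nL κ Φ t p D g f) (ℓL κ Φ t p D g f) (hL κ Φ t p D g f) (kgR κ Φ t p D mk) (kgW κ Φ t p D g f Wx) (KS.kgNR κ Φ t p D mk g f qx Wx)) : ℕ) : ℤ) = ((((((kgNv0 κ Φ t p D g f mk qx Wx) : ℕ)) : ℤ) - ((((KS.kgNR κ Φ t p D mk g f qx Wx) : ℕ)) : ℤ)) * (((kgR κ Φ t p D mk) : ℕ) : ℤ)) := by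
    unfold Skelφ.kgA₁; push_cast; ring
  have hR0 : (0 : ℤ) ≤ (((kgR κ Φ t p D mk) : ℕ) : ℤ) := by positivity
  have hprodA : (((((kgNv0 κ Φ t p D g f mk qx Wx) : ℕ)) : ℤ) - ((((KS.kgNR κ Φ t p D mk g f qx Wx) : ℕ)) : ℤ)) * (((kgR κ Φ t p D mk) : ℕ) : ℤ) ≤ 106 * (((kgR κ Φ t p D mk) : ℕ) : ℤ) := mul_le_mul_of_nonneg_right hdN hR0
  have hprodA0 : 0 ≤ (((((kgNv0 κ Φ t p D g f mk qx Wx) : ℕ)) : ℤ) - ((((KS.kgNR κ Φ t p D mk g f qx Wx) : ℕ)) : ℤ)) * (((kgR κ Φ t p D mk) : ℕ) : ℤ) := mul_nonneg hdN0 hR0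
  have hprod1 : 0 ≤ (((((kgM₁ (nL κ Φ t p D g f) (ℓL κ Φ t p D g f) (hL κ Φ t p D g f) (kgR κ Φ t p D mk) 0 (kgW κ Φ t p D g f Wx) (kgNv0 κ Φ t p D g f mk qx Wx))) : ℕ) : ℤ) - ((((kgM₁ (nL κ Φ t p D g f) (ℓL κ Φ t p D g f) (hL κ Φ t p D g f) (kgR κ Φ t p D mk) 0 (kgW κ Φ t p D g f Wx) (KS.kgNR κ Φ t p D mk g f qx Wx))) : ℕ) : ℤ)) * (((kgR κ Φ t p D mk) : ℕ) : ℤ) := mul_nonneg hΔ0 hR0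
  have hprod1' : (((((kgM₁ (nL κ Φ t p D g f) (ℓL κ Φ t p D g f) (hL κ Φ t p D g f) (kgR κ Φ t p D mk) 0 (kgW κ Φ t p D g f Wx) (kgNv0 κ Φ t p D g f mk qx Wx))) : ℕ) : ℤ) - ((((kgM₁ (nL κ Φ t p D g f) (ℓL κ Φ t p D g f) (hL κ Φ t p D g f) (kgR κ Φ t p D mk) 0 (kgW κ Φ t p D g f Wx) (KS.kgNR κ Φ t p D mk g f qx Wx))) : ℕ) : ℤ)) * (((kgR κ Φ t p D mk) : ℕ) : ℤ) ≤ 1 * (((kgR κ Φ t p D mk) : ℕ) : ℤ) := mul_le_mul_of_nonneg_right hΔ1 hR0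
  have hprod2 : 0 ≤ (((((kgM₂ (nL κ Φ t p D g f) (ℓL κ Φ t p D g f) (hL κ Φ t p D g f) (vL κ Φ t p D g f) (kgR κ Φ t p D mk) 0 (kgq κ Φ t p D g f qx) (kgW κ Φ t p D g f Wx) (kgNv0 κ Φ t p D g f mk qx Wx))) : ℕ) : ℤ) - ((((kgM₂ (nL κ Φ t p D g f) (ℓL κ Φ t p D g f) (hL κ Φ t p D g f) (vL κ Φ t p D g f) (kgR κ Φ t p D mk) 0 (kgq κ Φ t p D g f qx) (kgW κ Φ t p D g f Wx) (KS.kgNR κ Φ t p D mk g f qx Wx))) : ℕ) : ℤ)) * (((kgR κ Φ t p D mk) : ℕ) : ℤ) := mul_nonneg hΔ₂0 hR0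
  -- closed forms of the row corners' numerators
  have eS : ∀ N : ℕ, kgCtr2 (nL κ Φ t p D g f) (ℓL κ Φ t p D g f) (hL κ Φ t p D g f) (kgR κ Φ t p D mk) 0 (kgW κ Φ t p D g f Wx) N + kgHw2 (nL κ Φ t p D g f) (ℓL κ Φ t p D g f) (hL κ Φ t p D g f) (vL κ Φ t p D g f) (kgR κ Φ t p D mk) 0 (kgq κ Φ t p D g f qx) (kgW κ Φ t p D g f Wx) N =
      2 * ((Skelφ.kgA₁ (nL κ Φ t p D g f) (ℓL κ Φ t p D g f) (hL κ Φ t p D g f) (kgR κ Φ t p D mk) (kgW κ Φ t p D g f Wx) N : ℕ) : ℤ) + 2 * (((kgM₁ (nL κ Φ t p D g f) (ℓL κ Φ t p D g f) (hL κ Φ t p D g f) (kgR κ Φ t p D mk) 0 (kgW κ Φ t p D g f Wx) N : ℕ) : ℤ) + 1) * (((kgR κ Φ t p D mk) : ℕ) : ℤ) +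
        2 * (((kgM₂ (nL κ Φ t p D g f) (ℓL κ Φ t p D g f) (hL κ Φ t p D g f) (vL κ Φ t p D g f) (kgR κ Φ t p D mk) 0 (kgq κ Φ t p D g f qx) (kgW κ Φ t p D g f Wx) N : ℕ) : ℤ) + 1) * (((kgR κ Φ t p D mk) : ℕ) : ℤ) := by
    intro N; unfold kgCtr2 kgHw2; push_cast; ring
  have eD : ∀ N : ℕ, kgCtr2 (nL κ Φ t p D g f) (ℓL κ Φ t p D g f) (hL κ Φ t p D g f) (kgR κ Φ t p D mk) 0 (kgW κ Φ t p D g f Wx) N - kgHw2 (nL κ Φ t p D g f) (ℓL κ Φ t p D g f) (hL κ Φ t p D g f) (vL κ Φ t p D g f) (kgR κ Φ t p D mk) 0 (kgq κ Φ t p D g f qx) (kgW κ Φ t p D g f Wx) N =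
      2 * ((Skelφ.kgA₁ (nL κ Φ t p D g f) (ℓL κ Φ t p D g f) (hL κ Φ t p D g f) (kgR κ Φ t p D mk) (kgW κ Φ t p D g f Wx) N : ℕ) : ℤ) + 2 * (((kgM₁ (nL κ Φ t p D g f) (ℓL κ Φ t p D g f) (hL κ Φ t p D g f) (kgR κ Φ t p D mk) 0 (kgW κ Φ t p D g f Wx) N : ℕ) : ℤ) + 1) * (((kgR κ Φ t p D mk) : ℕ) : ℤ) -
        2 * ((Skelφ.kgE₁ (nL κ Φ t p D g f) (ℓL κ Φ t p D g f) (hL κ Φ t p D g f) (kgR κ Φ t p D mk) 0 (kgW κ Φ t p D g f Wx) N : ℕ) : ℤ) - 2 * (((kgM₂ (nL κ Φ t p D g f) (ℓL κ Φ t p D g f) (hL κ Φ t p D g f) (vL κ Φ t p D g f) (kgR κ Φ t p D mk) 0 (kgq κ Φ t p D g f qx) (kgW κ Φ t p D g f Wx) N : ℕ) : ℤ) + 1) * (((kgR κ Φ t p D mk) : ℕ) : ℤ) := by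
    intro N; unfold kgCtr2 kgHw2; push_cast; ring
  have hS := eS (KS.kgNR κ Φ t p D mk g f qx Wx)
  have hS' := eS (kgNv0 κ Φ t p D g f mk qx Wx)
  have hDf := eD (KS.kgNR κ Φ t p D mk g f qx Wx)
  have hDf' := eD (kgNv0 κ Φ t p D g f mk qx Wx)
  have rows_hi : kgCtr2 (nL κ Φ t p D g f) (ℓL κ Φ t p D g f) (hL κ Φ t p D g f) (kgR κ Φ t p D mk) 0 (kgW κ Φ t p D g f Wx) (KS.kgNR κ Φ t p D mk g f qx Wx) + kgHw2 (nL κ Φ t p D g f) (ℓL κ Φ t p D g f) (hL κ Φ t p D g f) (vL κ Φ t p D g f) (kgR κ Φ t p D mk) 0 (kgq κ Φ t p D g f qx) (kgW κ Φ t p D g f Wx) (KS.kgNR κ Φ t p D mk g f qx Wx) ≤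
      kgCtr2 (nL κ Φ t p D g f) (ℓL κ Φ t p D g f) (hL κ Φ t p D g f) (kgR κ Φ t p D mk) 0 (kgW κ Φ t p D g f Wx) (kgNv0 κ Φ t p D g f mk qx Wx) + kgHw2 (nL κ Φ t p D g f) (ℓL κ Φ t p D g f) (hL κ Φ t p D g f) (vL κ Φ t p D g f) (kgR κ Φ t p D mk) 0 (kgq κ Φ t p D g f qx) (kgW κ Φ t p D g f Wx) (kgNv0 κ Φ t p D g f mk qx Wx) := by
    linarith only [hS, hS', eA, hprodA0, hprod1, hprod2]
  have rows_lo : (kgCtr2 (nL κ Φ t p D g f) (ℓL κ Φ t p D g f) (hL κ Φ t p D g f) (kgR κ Φ t p D mk) 0 (kgW κ Φ t p D g f Wx) (kgNv0 κ Φ t p D g f mk qx Wx) - kgHw2 (nL κ Φ t p D g f) (ℓL κ Φ t p D g f) (hL κ Φ t p D g f) (vL κ Φ t p D g f) (kgR κ Φ t p D mk) 0 (kgq κ Φ t p D g f qx) (kgW κ Φ t p D g f Wx) (kgNv0 κ Φ t p D g f mk qx Wx) + 1) - 2 * (2 * (kgSL (nL κ Φ t p D g f) (ℓL κ Φ t p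 D g f) (hL κ Φ t p D g f))) ≤
      kgCtr2 (nL κ Φ t p D g f) (ℓL κ Φ t p D g f) (hL κ Φ t p D g f) (kgR κ Φ t p D mk) 0 (kgW κ Φ t p D g f Wx) (KS.kgNR κ Φ t p D mk g f qx Wx) - kgHw2 (nL κ Φ t p D g f) (ℓL κ Φ t p D g f) (hL κ Φ t p D g f) (vL κ Φ t p D g f) (kgR κ Φ t p D mk) 0 (kgq κ Φ t p D g f qx) (kgW κ Φ t p D g f Wx) (KS.kgNR κ Φ t p D mk g f qx Wx) + 1 := by
    linarith only [hDf, hDf', eA, hprodA, hprod1', hprod2, hER, hEC, h1600s, hR0, h958]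
  unfold kgFar at hC1 hC2 hR1' hR2'
  unfold kgΔ at hC2 hR2'
  push_cast at hC1 hC2 hR1' hR2'
  have hva : (0 : ℤ) ≤ |(vL κ Φ t p D g f)| := abs_nonneg _
  simp only [KGRows.kgLastLo, KGRows.kgLastHi, Matrix.cons_val_zero, Matrix.cons_val_one]
  push_cast
  refine ⟨?_, ?_, ?_, ?_⟩
  · linarith only [hC1, hR2', h8, hv, hR0]
  · linarith only [hR1', hC2, h8, hv, hR0]
  · omega
  · omega

end BoxX

end KS

end NegB

end PlanarSkeletonFrm

end Summit.CriticalPhenomena.PercolationContinuityZ3.Theorems.Transplant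

end
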